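import Mathlib
import Literature.NumberTheory.Irrationality.DirichletLValues.ChowlaMilnorSpaceProofs
import HarnessLib

/-!
# The Chowla–Milnor space at coprime moduli: Gun–Murty–Rath's Theorem 2 and Corollary 1 (unconditional)

Topic `Literature/NumberTheory/Irrationality/DirichletLValues`. Second proofs-only file on the UNCONDITIONAL half of
S. Gun, M. R. Murty, P. Rath, *On a conjecture of Chowla and Milnor*, Canad. J. Math. **63** (2011) 1328–1344
[GunRammurtyRath2011] (the first is `ChowlaMilnorSpaceProofs.lean`: the coprime sum and
`ζ(k) ∈ (2πi)^k·ℚ(e^{2πi/q})` under `dim_ℚ V_k(q) ≤ φ(q)/2`). Read on the page: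

* **Theorem 2** (p. 1330; proof pp. 1334–1335): "Let `k > 1` be an odd integer and `q > 2` and `r > 2` be two
  co-prime integers. Then either `dim_ℚ V_k(q) ≥ φ(q)/2 + 1` or `dim_ℚ V_k(r) ≥ φ(r)/2 + 1`. Thus in particular,
  there exists `q₀` such that `dim_ℚ V_k(q) ≥ φ(q)/2 + 1` for any `q` co-prime to `q₀`." Proof: otherwise
  "`ζ(k)/(iπ^k) ∈ ℚ(ζ_q) ∩ ℚ(ζ_r)`. Since `q` and `r` are co-prime, `ℚ(ζ_q) ∩ ℚ(ζ_r) = ℚ` and hence we arrive at a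
  contradiction."
* **Corollary 1** (p. 1335): "Let `k` be an odd integer. Then `dim_ℚ V_k(3) = 2` or `dim_ℚ V_k(4) = 2`."

## What is proved (theorems only; no definition is introduced)

`V_k(q) = Submodule.span ℚ {y | ∃ a, 1 ≤ a ∧ a < q ∧ Nat.Coprime a q ∧ y = hurwitzValue k (a/q)}` as in the first
file.

* `conj_eq_self_of_mem_adjoin_of_coprime` — exactly what the printed "`ℚ(ζ_q) ∩ ℚ(ζ_r) = ℚ`" is used for: an
  element of `ℚ(e^{2πi/q}) ∩ ℚ(e^{2πi/r})` (subalgebras `Algebra.adjoin ℚ {·}` of `ℂ`), `(q, r) = 1`, is fixed by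
  complex conjugation — by minimal-polynomial transport at `e^{2πi/(qr)}` (`cyclotomic_eq_minpoly_rat`, the device of
  the tree's Okada files) with ONE exponent `c ≡ 1 (q)`, `c ≡ −1 (r)` from `Nat.chineseRemainder`;
* **`finrank_chowlaMilnor_coprime`** — THEOREM 2 (for odd `k`, `ζ(k)/(2πi)^k` is purely imaginary and non-zero, so it
  cannot be fixed by conjugation); `exists_finrank_chowlaMilnor_of_coprime` — its "in particular";
  **`finrank_chowlaMilnor_three_or_four`** — COROLLARY 1 (`φ(3) = φ(4) = 2`, two generators each).

HONEST FRAMING (cells pub-zeta5 / zeta5-irr): kernel theorems of PRINTED, UNCONDITIONAL statements; net named-fact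
debt 0 (nothing introduced or discharged); the Chowla–Milnor conjecture stays OPEN and untyped; nothing here
concerns `ζ(5)`'s irrationality.
-/

noncomputable section

open Finset Complex Polynomial

open scoped Nat

namespace Literature.NumberTheory.Irrationality.DirichletLValues

open Literature.NumberTheory.Transcendental

/-! ### What `ℚ(ζ_q) ∩ ℚ(ζ_r) = ℚ` is used for: elements of the intersection are real -/

/-- `x^a = x^b` for `x^q = 1` and `a ≡ b (mod q)`. [folklore] -/
private theorem pow_eq_pow_of_modEq {x : ℂ} {q a b : ℕ} (hx : x ^ q = 1) (h : a ≡ b [MOD q]) :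
    x ^ a = x ^ b := by
  rw [pow_eq_pow_mod a hx, pow_eq_pow_mod b hx, h]

/-- Rational polynomial maps commute with complex conjugation. [folklore] -/
private theorem aeval_conj (y : ℂ) (P : ℚ[X]) : aeval (starRingEnd ℂ y) P = starRingEnd ℂ (aeval y P) := by
  rw [Polynomial.aeval_def, Polynomial.aeval_def, Polynomial.hom_eval₂]
  congr 1
  exact RingHom.ext_rat _ _

/-- `e^{2πi/r}` raised to `r − 1` is its complex conjugate (`= e^{−2πi/r}`). [folklore] -/
private theorem exp_pow_sub_one_eq_conj {r : ℕ} (hr : r ≠ 0) :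
    Complex.exp (2 * Real.pi * I / r) ^ (r - 1) = starRingEnd ℂ (Complex.exp (2 * Real.pi * I / r)) := by
  have hy : Complex.exp (2 * Real.pi * I / r) ^ r = 1 := (Complex.isPrimitiveRoot_exp r hr).pow_eq_one
  have hy0 : Complex.exp (2 * Real.pi * I / r) ≠ 0 := Complex.exp_ne_zero _
  have h1 : Complex.exp (2 * Real.pi * I / r) ^ (r - 1) = (Complex.exp (2 * Real.pi * I / r))⁻¹ :=
    eq_inv_of_mul_eq_one_left (by rw [pow_sub_one_mul hr, hy])
  rw [h1, ← Complex.exp_conj, ← Complex.exp_neg]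
  congr 1
  simp only [map_div₀, map_mul, map_natCast, Complex.conj_ofReal, Complex.conj_I, map_ofNat]
  ring

/-- **What the printed "`ℚ(ζ_q) ∩ ℚ(ζ_r) = ℚ`" (coprime `q, r`) is used for**: a complex number lying in both
`ℚ(e^{2πi/q})` and `ℚ(e^{2πi/r})` (as subalgebras `Algebra.adjoin ℚ {·}` of `ℂ`) is fixed by complex conjugation.
Proof: write `z = P(ζ_q) = Q(ζ_r)` with `P, Q ∈ ℚ[X]`, `ζ_q = ζ^r`, `ζ_r = ζ^q`, `ζ = e^{2πi/(qr)}`; the rational polynomial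
`P(X^r) − Q(X^q)` vanishes at `ζ`, hence (irreducibility of `Φ_{qr}`, `cyclotomic_eq_minpoly_rat`) at `ζ^c` for the
exponent `c ≡ 1 (mod q)`, `c ≡ −1 (mod r)` (Chinese remainder theorem); there it reads `P(ζ_q) = Q(ζ̄_r) = z̄`.
[cite: GunRammurtyRath2011, proof of Theorem 2 (p. 1335: "Since q and r are co-prime, ℚ(ζ_q) ∩ ℚ(ζ_r) = ℚ")] -/
theorem conj_eq_self_of_mem_adjoin_of_coprime {q r : ℕ} (hq : q ≠ 0) (hr : r ≠ 0) (hqr : Nat.Coprime q r) {z : ℂ}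
    (hzq : z ∈ Algebra.adjoin ℚ ({Complex.exp (2 * Real.pi * I / q)} : Set ℂ))
    (hzr : z ∈ Algebra.adjoin ℚ ({Complex.exp (2 * Real.pi * I / r)} : Set ℂ)) :
    starRingEnd ℂ z = z := by
  -- the primitive `qr`-th root of unity and its powers
  set ζ : ℂ := Complex.exp (2 * Real.pi * I / (q * r : ℕ)) with hζdef
  have hN : q * r ≠ 0 := mul_ne_zero hq hr
  have hζ : IsPrimitiveRoot ζ (q * r) := Complex.isPrimitiveRoot_exp (q * r) hN
  have hqC : (q : ℂ) ≠ 0 := by exact_mod_cast hq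
  have hrC : (r : ℂ) ≠ 0 := by exact_mod_cast hr
  have hq' : Complex.exp (2 * Real.pi * I / q) = ζ ^ r := by
    rw [hζdef, ← Complex.exp_nat_mul]
    congr 1
    push_cast
    field_simp
  have hr' : Complex.exp (2 * Real.pi * I / r) = ζ ^ q := by
    rw [hζdef, ← Complex.exp_nat_mul]
    congr 1
    push_cast
    field_simp
  -- polynomial representatives
  rw [Algebra.adjoin_singleton_eq_range_aeval] at hzq hzr
  obtain ⟨P, hP'⟩ := hzq
  obtain ⟨Q, hQ'⟩ := hzr
  have hP : aeval (Complex.exp (2 * Real.pi * I / q)) P = z := hP'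
  have hQ : aeval (Complex.exp (2 * Real.pi * I / r)) Q = z := hQ'
  -- the exponent `c ≡ 1 (q)`, `c ≡ r - 1 (r)`, coprime to `qr`
  obtain ⟨c, hc1, hc2⟩ := Nat.chineseRemainder hqr 1 (r - 1)
  have hcq : c.Coprime q := by
    rw [Nat.Coprime, hc1.gcd_eq]
    exact Nat.gcd_one_left q
  have hcr : c.Coprime r := by
    rw [Nat.Coprime, hc2.gcd_eq]
    exact (Nat.coprime_self_sub_left (Nat.one_le_iff_ne_zero.2 hr)).2 (Nat.coprime_one_left r)
  have hc : c.Coprime (q * r) := Nat.Coprime.mul_right hcq hcr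
  -- the rational polynomial `P(X^r) − Q(X^q)` vanishes at `ζ`, hence at `ζ^c`
  have hF0 : aeval ζ (P.comp (X ^ r) - Q.comp (X ^ q)) = 0 := by
    simp only [map_sub, Polynomial.aeval_comp, map_pow, Polynomial.aeval_X]
    rw [← hq', ← hr', hP, hQ, sub_self]
  have hFc : aeval (ζ ^ c) (P.comp (X ^ r) - Q.comp (X ^ q)) = 0 := by
    have hζc := hζ.pow_of_coprime c hc
    have hpos : 0 < q * r := Nat.pos_of_ne_zero hN
    have hdvd : minpoly ℚ (ζ ^ c) ∣ P.comp (X ^ r) - Q.comp (X ^ q) := by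
      rw [← Polynomial.cyclotomic_eq_minpoly_rat hζc hpos, Polynomial.cyclotomic_eq_minpoly_rat hζ hpos]
      exact minpoly.dvd ℚ _ hF0
    obtain ⟨R, hR⟩ := hdvd
    rw [hR, map_mul, minpoly.aeval, zero_mul]
  -- at `ζ^c`: `P((ζ^c)^r) = P(ζ_q^c) = P(ζ_q) = z`
  have e1 : aeval (ζ ^ c) (P.comp (X ^ r)) = z := by
    rw [Polynomial.aeval_comp, map_pow, aeval_X, ← pow_mul, mul_comm, pow_mul, ← hq',
      pow_eq_pow_of_modEq (Complex.isPrimitiveRoot_exp q hq).pow_eq_one hc1, pow_one, hP]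
  -- and `Q((ζ^c)^q) = Q(ζ_r^c) = Q(ζ_r^{r-1}) = Q(ζ̄_r) = z̄`
  have e2 : aeval (ζ ^ c) (Q.comp (X ^ q)) = starRingEnd ℂ z := by
    rw [Polynomial.aeval_comp, map_pow, aeval_X, ← pow_mul, mul_comm, pow_mul, ← hr',
      pow_eq_pow_of_modEq (Complex.isPrimitiveRoot_exp r hr).pow_eq_one hc2, exp_pow_sub_one_eq_conj hr,
      aeval_conj, hQ]
  have h0 : z - starRingEnd ℂ z = 0 := by
    rw [← hFc, map_sub, e1, e2]
  linear_combination -h0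

/-! ### Theorem 2 and Corollary 1 -/

/-- **Gun–Murty–Rath 2011, Theorem 2.** "Let `k > 1` be an odd integer and `q > 2` and `r > 2` be two co-prime
integers. Then either `dim_ℚ V_k(q) ≥ φ(q)/2 + 1` or `dim_ℚ V_k(r) ≥ φ(r)/2 + 1`", with
`V_k(q) = Span_ℚ {ζ(k, a/q) : 1 ≤ a < q, (a,q) = 1}` (Definition 1) written out over the tree's `hurwitzValue`.
Proof as printed: if both dimensions are `≤ φ/2`, then `ζ(k)/(2πi)^k` lies in `ℚ(ζ_q) ∩ ℚ(ζ_r)`, hence is fixed by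
complex conjugation (`conj_eq_self_of_mem_adjoin_of_coprime`); but for odd `k` it is a non-zero purely imaginary
number. [cite: GunRammurtyRath2011, Theorem 2 (p. 1330; proof pp. 1334–1335)] -/
theorem finrank_chowlaMilnor_coprime {k q r : ℕ} (hk : Odd k) (hk1 : 1 < k) (hq : 2 < q) (hr : 2 < r)
    (hqr : Nat.Coprime q r) :
    Nat.totient q / 2 + 1 ≤ Module.finrank ℚ ↥(Submodule.span ℚ {y : ℝ | ∃ a : ℕ, 1 ≤ a ∧ a < q ∧
        Nat.Coprime a q ∧ y = hurwitzValue k ((a : ℝ) / q)}) ∨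
      Nat.totient r / 2 + 1 ≤ Module.finrank ℚ ↥(Submodule.span ℚ {y : ℝ | ∃ a : ℕ, 1 ≤ a ∧ a < r ∧
        Nat.Coprime a r ∧ y = hurwitzValue k ((a : ℝ) / r)}) := by
  by_contra hcon
  rw [not_or, not_le, not_le] at hcon
  obtain ⟨h1, h2⟩ := hcon
  have hk2 : 2 ≤ k := hk1
  obtain ⟨z, hz, ez⟩ := zetaValue_mem_cyclotomic_of_finrank_le hk2 hq (by omega)
  obtain ⟨w, hw, ew⟩ := zetaValue_mem_cyclotomic_of_finrank_le hk2 hr (by omega)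
  have hpi : (2 * Real.pi * I : ℂ) ^ k ≠ 0 := pow_ne_zero _ Complex.two_pi_I_ne_zero
  have hzw : z = w := mul_left_cancel₀ hpi (ez.symm.trans ew)
  have hconj : starRingEnd ℂ z = z :=
    conj_eq_self_of_mem_adjoin_of_coprime (by omega) (by omega) hqr hz (hzw ▸ hw)
  -- for odd `k`, `z = ζ(k)/(2πi)^k` is purely imaginary: `z̄ = −z`
  have hneg : starRingEnd ℂ z = -z := by
    have e1 : z = ((zetaValue k : ℝ) : ℂ) / (2 * Real.pi * I) ^ k := by
      rw [ez]
      field_simp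
    have e2 : starRingEnd ℂ (2 * Real.pi * I) = -(2 * Real.pi * I) := by
      simp only [map_mul, Complex.conj_ofReal, Complex.conj_I, map_ofNat]
      ring
    rw [e1, map_div₀, Complex.conj_ofReal, map_pow, e2, Odd.neg_pow hk, div_neg]
  have hzz : -z = z := hneg.symm.trans hconj
  have hz0 : z = 0 := by
    linear_combination (-1 / 2 : ℂ) * hzz
  have hzeta : ((zetaValue k : ℝ) : ℂ) = 0 := by rw [ez, hz0, mul_zero]
  exact (zetaValue_pos_of_two_le hk2).ne' (by exact_mod_cast hzeta)

/-- **Theorem 2, "in particular"**: "there exists `q₀` such that `dim_ℚ V_k(q) ≥ φ(q)/2 + 1` for any `q` co-prime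
to `q₀`" (`q > 2`, `k > 1` odd): either every `q > 2` qualifies (`q₀ = 1`), or some `q₁ > 2` fails and `q₀ = q₁` works
by Theorem 2. [cite: GunRammurtyRath2011, Theorem 2 (p. 1330)] -/
theorem exists_finrank_chowlaMilnor_of_coprime {k : ℕ} (hk : Odd k) (hk1 : 1 < k) :
    ∃ q₀ : ℕ, 1 ≤ q₀ ∧ ∀ q : ℕ, 2 < q → Nat.Coprime q q₀ →
      Nat.totient q / 2 + 1 ≤ Module.finrank ℚ ↥(Submodule.span ℚ {y : ℝ | ∃ a : ℕ, 1 ≤ a ∧ a < q ∧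
        Nat.Coprime a q ∧ y = hurwitzValue k ((a : ℝ) / q)}) := by
  by_cases h : ∀ q : ℕ, 2 < q → Nat.totient q / 2 + 1 ≤ Module.finrank ℚ ↥(Submodule.span ℚ {y : ℝ |
      ∃ a : ℕ, 1 ≤ a ∧ a < q ∧ Nat.Coprime a q ∧ y = hurwitzValue k ((a : ℝ) / q)})
  · exact ⟨1, le_rfl, fun q hq _ => h q hq⟩
  · simp only [not_forall, not_le, exists_prop] at h
    obtain ⟨q₁, hq₁, hlt⟩ := h
    refine ⟨q₁, by omega, fun q hq hcop => ?_⟩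
    rcases finrank_chowlaMilnor_coprime hk hk1 hq hq₁ hcop with h1 | h2
    · exact h1
    · exact absurd h2 (not_le.2 hlt)

/-- `dim_ℚ Span_ℚ S ≤ #F` whenever `S ⊆ F` for a finite set `F`. [folklore] -/
private theorem finrank_span_le_of_subset {S : Set ℝ} (F : Finset ℝ) (h : S ⊆ (F : Set ℝ)) :
    Module.finrank ℚ ↥(Submodule.span ℚ S) ≤ F.card :=
  (Submodule.finrank_mono (Submodule.span_mono h)).trans (finrank_span_finset_le_card F)

/-- **Gun–Murty–Rath 2011, Corollary 1.** "Let `k` be an odd integer [`k > 1`]. Then `dim_ℚ V_k(3) = 2` or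
`dim_ℚ V_k(4) = 2`": Theorem 2 at the coprime pair `(3, 4)` (`φ(3)/2 + 1 = φ(4)/2 + 1 = 2`), the spaces having the
two generators `ζ(k,1/3), ζ(k,2/3)`, resp. `ζ(k,1/4), ζ(k,3/4)`. [cite: GunRammurtyRath2011, Corollary 1 (p. 1335)] -/
theorem finrank_chowlaMilnor_three_or_four {k : ℕ} (hk : Odd k) (hk1 : 1 < k) :
    Module.finrank ℚ ↥(Submodule.span ℚ {y : ℝ | ∃ a : ℕ, 1 ≤ a ∧ a < 3 ∧ Nat.Coprime a 3 ∧
        y = hurwitzValue k ((a : ℝ) / (3 : ℕ))}) = 2 ∨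
      Module.finrank ℚ ↥(Submodule.span ℚ {y : ℝ | ∃ a : ℕ, 1 ≤ a ∧ a < 4 ∧ Nat.Coprime a 4 ∧
        y = hurwitzValue k ((a : ℝ) / (4 : ℕ))}) = 2 := by
  have h3 : Module.finrank ℚ ↥(Submodule.span ℚ {y : ℝ | ∃ a : ℕ, 1 ≤ a ∧ a < 3 ∧ Nat.Coprime a 3 ∧
      y = hurwitzValue k ((a : ℝ) / (3 : ℕ))}) ≤ 2 := by
    refine (finrank_span_le_of_subset {hurwitzValue k (((1 : ℕ) : ℝ) / (3 : ℕ)),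
      hurwitzValue k (((2 : ℕ) : ℝ) / (3 : ℕ))} ?_).trans Finset.card_le_two
    rintro y ⟨a, ha1, ha3, -, rfl⟩
    interval_cases a <;> simp
  have h4 : Module.finrank ℚ ↥(Submodule.span ℚ {y : ℝ | ∃ a : ℕ, 1 ≤ a ∧ a < 4 ∧ Nat.Coprime a 4 ∧
      y = hurwitzValue k ((a : ℝ) / (4 : ℕ))}) ≤ 2 := by
    refine (finrank_span_le_of_subset {hurwitzValue k (((1 : ℕ) : ℝ) / (4 : ℕ)),
      hurwitzValue k (((3 : ℕ) : ℝ) / (4 : ℕ))} ?_).trans Finset.card_le_two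
    rintro y ⟨a, ha1, ha4, hcop, rfl⟩
    interval_cases a
    · simp
    · exact absurd hcop (by decide)
    · simp
  have hφ3 : Nat.totient 3 = 2 := by decide
  have hφ4 : Nat.totient 4 = 2 := by decide
  rcases finrank_chowlaMilnor_coprime hk hk1 (q := 3) (r := 4) (by norm_num) (by norm_num) (by norm_num)
    with h | h
  · rw [hφ3] at h
    exact Or.inl (le_antisymm h3 h)
  · rw [hφ4] at h
    exact Or.inr (le_antisymm h4 h)

end Literature.NumberTheory.Irrationality.DirichletLValues

end
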